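import Mathlib

/-!
# CONJECTURE H_K is a THEOREM: the additive three-coin bound for every family of K-dominant petals

Normalised three-coin petals (prove-1 g54 memo §7(g)(xii)–(xiii)): weights `c, ε_Y, ε_g, ε_h ≥ 0` with `c + ε_Y + ε_g + ε_h = 1`;
a petal has usages `x ≥ 1` (Ȳ-face), `k ≥ r ≥ 1` (k-cell ≥ h-cell: the class `h ≤ k`, "K-dominant"), and value
`V = c + ε_Y x + ε_g k + ε_h r` (g raised to k, which only increases the value).  A petal is COVERED if
`(1 − ε_Y)(x − 1) ≥ ε_g(k − 1) + ε_h(r − 1)` (in the model: the leaf-leaf-constant tying, `model_tying_A`).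

**`classK_prod_le` (H_K, all n):** if every petal has `1 ≤ r_j ≤ k_j`, `1 ≤ x_j`, and every petal with `x_j < k_j` is covered, then
`∏_j V_j ≤ c + ε_Y ∏x_j + ε_g ∏k_j + ε_h ∏r_j  (= 1 + ε_Y(X−1) + ε_g(K−1) + ε_h(R−1) = Φ_K)`.

PROOF.  The insertion increment has the Chebyshev form
`Φ_K(T∪P) − V_P Φ_K(T) = c[ε_Y(X−1)(x−1) + ε_g(K−1)(k−1) + ε_h(R−1)(r−1)] + ε_Yε_g(X−K)(x−k) + ε_Yε_h(X−R)(x−r) + ε_gε_h(K−R)(k−r)`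
(`X,K,R` the merged usages of `T`).  Petal TYPES by the position of `x` in `r ≤ k`: A (`x ≥ k`), B (`r ≤ x < k`), C (`x < r`); state types of
`T` likewise by the position of `X` in `R ≤ K`.  Same type ⇒ all six terms `≥ 0` (comonotone, `step_same_*`); state A absorbs ANY covered petal
(`step_stateA`), state B absorbs a covered type-C petal (`step_stateB_petalC`) — in both cases the negative cross terms are bounded by
`ε_Y(X−K)·cover` resp. `ε_Y(X−1)·cover`.  Peeling order for the induction on `|S|`: remove a type-C petal if there is one (the rest is in state
A, B or C — all three cases are lemmas), else a type-B petal (the rest has `x_j ≥ r_j` throughout, so state A or B), else any petal (all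
type A, state A).  In the sunflower model this gives (RES0′) for EVERY n on the whole class `h_j ≤ k_j` from (BȲ),(Bk),(Bh) and the
leaf-leaf constant (the cover) — to be instantiated as `res0_comonotone` was.  [this work]
-/

namespace Summit.CriticalPhenomena.PercolationContinuityZ3.Theorems.SunflowerPartition.SafeCalc.LinkedCurrency

open Finset

section Steps

variable {c εY εg εh X K R x k r : ℝ}

/-- The Chebyshev form of the insertion increment (pure algebra, `c + ε_Y + ε_g + ε_h = 1`). [this work] -/
theorem hk_step_identity (hsum : c + εY + εg + εh = 1) (X K R x k r : ℝ) :
    (c + εY * (X * x) + εg * (K * k) + εh * (R * r)) - (c + εY * X + εg * K + εh * R) * (c + εY * x + εg * k + εh * r) =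
      c * (εY * ((X - 1) * (x - 1)) + εg * ((K - 1) * (k - 1)) + εh * ((R - 1) * (r - 1))) +
      εY * εg * ((X - K) * (x - k)) + εY * εh * ((X - R) * (x - r)) + εg * εh * ((K - R) * (k - r)) := by
  have hc : c = 1 - εY - εg - εh := by linarith
  rw [hc]; ring

/-- Same type A (state `X ≥ K ≥ R ≥ 1`, petal `x ≥ k ≥ r ≥ 1`): comonotone step. [this work] -/
theorem step_same_A (hc : 0 ≤ c) (hY : 0 ≤ εY) (hg : 0 ≤ εg) (hh : 0 ≤ εh) (hsum : c + εY + εg + εh = 1)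
    (hR : 1 ≤ R) (hRK : R ≤ K) (hKX : K ≤ X) (hr : 1 ≤ r) (hrk : r ≤ k) (hkx : k ≤ x) :
    (c + εY * X + εg * K + εh * R) * (c + εY * x + εg * k + εh * r) ≤ c + εY * (X * x) + εg * (K * k) + εh * (R * r) := by
  have e := hk_step_identity hsum X K R x k r
  have t1 : 0 ≤ εY * ((X - 1) * (x - 1)) := mul_nonneg hY (mul_nonneg (by linarith) (by linarith))
  have t2 : 0 ≤ εg * ((K - 1) * (k - 1)) := mul_nonneg hg (mul_nonneg (by linarith) (by linarith))
  have t3 : 0 ≤ εh * ((R - 1) * (r - 1)) := mul_nonneg hh (mul_nonneg (by linarith) (by linarith))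
  have t4 : 0 ≤ εY * εg * ((X - K) * (x - k)) := mul_nonneg (mul_nonneg hY hg) (mul_nonneg (by linarith) (by linarith))
  have t5 : 0 ≤ εY * εh * ((X - R) * (x - r)) := mul_nonneg (mul_nonneg hY hh) (mul_nonneg (by linarith) (by linarith))
  have t6 : 0 ≤ εg * εh * ((K - R) * (k - r)) := mul_nonneg (mul_nonneg hg hh) (mul_nonneg (by linarith) (by linarith))
  nlinarith [mul_nonneg hc (add_nonneg (add_nonneg t1 t2) t3)]

/-- Same type B (state `R ≤ X ≤ K`, petal `r ≤ x ≤ k`, all `≥ 1`): comonotone step. [this work] -/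
theorem step_same_B (hc : 0 ≤ c) (hY : 0 ≤ εY) (hg : 0 ≤ εg) (hh : 0 ≤ εh) (hsum : c + εY + εg + εh = 1)
    (hR : 1 ≤ R) (hRX : R ≤ X) (hXK : X ≤ K) (hr : 1 ≤ r) (hrx : r ≤ x) (hxk : x ≤ k) :
    (c + εY * X + εg * K + εh * R) * (c + εY * x + εg * k + εh * r) ≤ c + εY * (X * x) + εg * (K * k) + εh * (R * r) := by
  have e := hk_step_identity hsum X K R x k r
  have t1 : 0 ≤ εY * ((X - 1) * (x - 1)) := mul_nonneg hY (mul_nonneg (by linarith) (by linarith))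
  have t2 : 0 ≤ εg * ((K - 1) * (k - 1)) := mul_nonneg hg (mul_nonneg (by linarith) (by linarith))
  have t3 : 0 ≤ εh * ((R - 1) * (r - 1)) := mul_nonneg hh (mul_nonneg (by linarith) (by linarith))
  have t4 : 0 ≤ εY * εg * ((X - K) * (x - k)) :=
    mul_nonneg (mul_nonneg hY hg) (mul_nonneg_of_nonpos_of_nonpos (by linarith) (by linarith))
  have t5 : 0 ≤ εY * εh * ((X - R) * (x - r)) := mul_nonneg (mul_nonneg hY hh) (mul_nonneg (by linarith) (by linarith))
  have t6 : 0 ≤ εg * εh * ((K - R) * (k - r)) := mul_nonneg (mul_nonneg hg hh) (mul_nonneg (by linarith) (by linarith))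
  nlinarith [mul_nonneg hc (add_nonneg (add_nonneg t1 t2) t3)]

/-- Same type C (state `X ≤ R ≤ K`, petal `x ≤ r ≤ k`, all `≥ 1`): comonotone step. [this work] -/
theorem step_same_C (hc : 0 ≤ c) (hY : 0 ≤ εY) (hg : 0 ≤ εg) (hh : 0 ≤ εh) (hsum : c + εY + εg + εh = 1)
    (hX : 1 ≤ X) (hXR : X ≤ R) (hRK : R ≤ K) (hx : 1 ≤ x) (hxr : x ≤ r) (hrk : r ≤ k) :
    (c + εY * X + εg * K + εh * R) * (c + εY * x + εg * k + εh * r) ≤ c + εY * (X * x) + εg * (K * k) + εh * (R * r) := by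
  have e := hk_step_identity hsum X K R x k r
  have t1 : 0 ≤ εY * ((X - 1) * (x - 1)) := mul_nonneg hY (mul_nonneg (by linarith) (by linarith))
  have t2 : 0 ≤ εg * ((K - 1) * (k - 1)) := mul_nonneg hg (mul_nonneg (by linarith) (by linarith))
  have t3 : 0 ≤ εh * ((R - 1) * (r - 1)) := mul_nonneg hh (mul_nonneg (by linarith) (by linarith))
  have t4 : 0 ≤ εY * εg * ((X - K) * (x - k)) :=
    mul_nonneg (mul_nonneg hY hg) (mul_nonneg_of_nonpos_of_nonpos (by linarith) (by linarith))
  have t5 : 0 ≤ εY * εh * ((X - R) * (x - r)) :=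
    mul_nonneg (mul_nonneg hY hh) (mul_nonneg_of_nonpos_of_nonpos (by linarith) (by linarith))
  have t6 : 0 ≤ εg * εh * ((K - R) * (k - r)) := mul_nonneg (mul_nonneg hg hh) (mul_nonneg (by linarith) (by linarith))
  nlinarith [mul_nonneg hc (add_nonneg (add_nonneg t1 t2) t3)]

/-- **State A absorbs any covered class petal.**  State `X ≥ K ≥ R ≥ 1`; petal `1 ≤ r ≤ k`, `1 ≤ x`, covered:
`εg(k−1) + εh(r−1) ≤ (c+εg+εh)(x−1)` (= `(1−ε_Y)(x−1)`). [this work] -/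
theorem step_stateA (hc : 0 ≤ c) (hY : 0 ≤ εY) (hg : 0 ≤ εg) (hh : 0 ≤ εh) (hsum : c + εY + εg + εh = 1)
    (hR : 1 ≤ R) (hRK : R ≤ K) (hKX : K ≤ X) (hx : 1 ≤ x) (hr : 1 ≤ r) (hrk : r ≤ k)
    (hcov : εg * (k - 1) + εh * (r - 1) ≤ (c + εg + εh) * (x - 1)) :
    (c + εY * X + εg * K + εh * R) * (c + εY * x + εg * k + εh * r) ≤ c + εY * (X * x) + εg * (K * k) + εh * (R * r) := by
  have e := hk_step_identity hsum X K R x k r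
  have t2 : 0 ≤ εg * ((K - 1) * (k - 1)) := mul_nonneg hg (mul_nonneg (by linarith) (by linarith))
  have t3 : 0 ≤ εh * ((R - 1) * (r - 1)) := mul_nonneg hh (mul_nonneg (by linarith) (by linarith))
  have t6 : 0 ≤ εg * εh * ((K - R) * (k - r)) := mul_nonneg (mul_nonneg hg hh) (mul_nonneg (by linarith) (by linarith))
  -- the ε_Y-terms: c ε_Y (X−1)(x−1) + ε_Yε_g(X−K)(x−k) + ε_Yε_h(X−R)(x−r) ≥ 0, by cases on the position of x
  have key : 0 ≤ c * (εY * ((X - 1) * (x - 1))) + εY * εg * ((X - K) * (x - k)) + εY * εh * ((X - R) * (x - r)) := by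
    rcases le_total k x with hkx | hxk
    · -- type A petal: everything nonnegative
      have t4 : 0 ≤ εY * εg * ((X - K) * (x - k)) := mul_nonneg (mul_nonneg hY hg) (mul_nonneg (by linarith) (by linarith))
      have t5 : 0 ≤ εY * εh * ((X - R) * (x - r)) := mul_nonneg (mul_nonneg hY hh) (mul_nonneg (by linarith) (by linarith))
      nlinarith [mul_nonneg hc (mul_nonneg hY (mul_nonneg (by linarith : (0:ℝ) ≤ X - 1) (by linarith : (0:ℝ) ≤ x - 1)))]
    rcases le_total r x with hrx | hxr
    · -- type B petal (r ≤ x ≤ k): lower the two nonnegative terms to the factor (X − K)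
      have a1 : c * (εY * ((X - K) * (x - 1))) ≤ c * (εY * ((X - 1) * (x - 1))) := by
        apply mul_le_mul_of_nonneg_left _ hc; apply mul_le_mul_of_nonneg_left _ hY
        nlinarith
      have a2 : εY * εh * ((X - K) * (x - r)) ≤ εY * εh * ((X - R) * (x - r)) := by
        apply mul_le_mul_of_nonneg_left _ (mul_nonneg hY hh); nlinarith
      have a3 : 0 ≤ εY * (X - K) * (c * (x - 1) + εh * (x - r) + εg * (x - k)) :=
        mul_nonneg (mul_nonneg hY (by linarith)) (by nlinarith)
      nlinarith
    · -- type C petal (x ≤ r ≤ k): lower both negative terms to the factor (X − 1)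
      have a1 : εY * εg * ((X - 1) * (x - k)) ≤ εY * εg * ((X - K) * (x - k)) := by
        apply mul_le_mul_of_nonneg_left _ (mul_nonneg hY hg); nlinarith
      have a2 : εY * εh * ((X - 1) * (x - r)) ≤ εY * εh * ((X - R) * (x - r)) := by
        apply mul_le_mul_of_nonneg_left _ (mul_nonneg hY hh); nlinarith
      have a3 : 0 ≤ εY * (X - 1) * (c * (x - 1) + εg * (x - k) + εh * (x - r)) :=
        mul_nonneg (mul_nonneg hY (by linarith)) (by nlinarith)
      nlinarith
  nlinarith [mul_nonneg hc (add_nonneg t2 t3)]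

/-- **State B absorbs a covered type-C petal.**  State `1 ≤ R ≤ X ≤ K`; petal `1 ≤ x ≤ r ≤ k`, covered. [this work] -/
theorem step_stateB_petalC (hc : 0 ≤ c) (hY : 0 ≤ εY) (hg : 0 ≤ εg) (hh : 0 ≤ εh) (hsum : c + εY + εg + εh = 1)
    (hR : 1 ≤ R) (hRX : R ≤ X) (hXK : X ≤ K) (hx : 1 ≤ x) (hxr : x ≤ r) (hrk : r ≤ k)
    (hcov : εg * (k - 1) + εh * (r - 1) ≤ (c + εg + εh) * (x - 1)) :
    (c + εY * X + εg * K + εh * R) * (c + εY * x + εg * k + εh * r) ≤ c + εY * (X * x) + εg * (K * k) + εh * (R * r) := by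
  have e := hk_step_identity hsum X K R x k r
  have t2 : 0 ≤ εg * ((K - 1) * (k - 1)) := mul_nonneg hg (mul_nonneg (by linarith) (by linarith))
  have t3 : 0 ≤ εh * ((R - 1) * (r - 1)) := mul_nonneg hh (mul_nonneg (by linarith) (by linarith))
  have t4 : 0 ≤ εY * εg * ((X - K) * (x - k)) :=
    mul_nonneg (mul_nonneg hY hg) (mul_nonneg_of_nonpos_of_nonpos (by linarith) (by linarith))
  have t6 : 0 ≤ εg * εh * ((K - R) * (k - r)) := mul_nonneg (mul_nonneg hg hh) (mul_nonneg (by linarith) (by linarith))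
  have a2 : εY * εh * ((X - 1) * (x - r)) ≤ εY * εh * ((X - R) * (x - r)) := by
    apply mul_le_mul_of_nonneg_left _ (mul_nonneg hY hh); nlinarith
  have a3 : 0 ≤ εY * (X - 1) * (c * (x - 1) + εh * (x - r)) :=
    mul_nonneg (mul_nonneg hY (by linarith)) (by nlinarith)
  nlinarith [mul_nonneg hc (add_nonneg t2 t3)]

end Steps

/-- **H_K FOR EVERY NUMBER OF PETALS.**  Weights `c, ε_Y, ε_g, ε_h ≥ 0` summing to `1`; a finite family of petals with
`1 ≤ x_j`, `1 ≤ r_j ≤ k_j`, each covered: `ε_g(k_j−1) + ε_h(r_j−1) ≤ (c+ε_g+ε_h)(x_j−1)`.  Then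
`∏_j (c + ε_Y x_j + ε_g k_j + ε_h r_j) ≤ c + ε_Y ∏x_j + ε_g ∏k_j + ε_h ∏r_j`. [this work] -/
theorem classK_prod_le {ι : Type*} [DecidableEq ι] {c εY εg εh : ℝ} (hc : 0 ≤ c) (hY : 0 ≤ εY) (hg : 0 ≤ εg)
    (hh : 0 ≤ εh) (hsum : c + εY + εg + εh = 1) (x k r : ι → ℝ) :
    ∀ (S : Finset ι), (∀ j ∈ S, 1 ≤ x j) → (∀ j ∈ S, 1 ≤ r j) → (∀ j ∈ S, r j ≤ k j) →
      (∀ j ∈ S, εg * (k j - 1) + εh * (r j - 1) ≤ (c + εg + εh) * (x j - 1)) →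
      ∏ j ∈ S, (c + εY * x j + εg * k j + εh * r j) ≤ c + εY * ∏ j ∈ S, x j + εg * ∏ j ∈ S, k j + εh * ∏ j ∈ S, r j := by
  intro S
  induction' hcard : S.card with n ih generalizing S
  · intro _ _ _ _
    rw [Finset.card_eq_zero.1 hcard]; simp; linarith
  · intro hx hr hrk hcov
    -- choose the petal to peel: a type-C petal if any, else a type-B petal if any, else any petal
    have hne : S.Nonempty := Finset.card_pos.1 (by omega)
    -- generic peeling step, given a petal i ∈ S and a step lemma for (S.erase i, i)
    have peel : ∀ i ∈ S,
        ((c + εY * ∏ j ∈ S.erase i, x j + εg * ∏ j ∈ S.erase i, k j + εh * ∏ j ∈ S.erase i, r j) *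
            (c + εY * x i + εg * k i + εh * r i) ≤
          c + εY * ((∏ j ∈ S.erase i, x j) * x i) + εg * ((∏ j ∈ S.erase i, k j) * k i) + εh * ((∏ j ∈ S.erase i, r j) * r i)) →
        ∏ j ∈ S, (c + εY * x j + εg * k j + εh * r j) ≤
          c + εY * ∏ j ∈ S, x j + εg * ∏ j ∈ S, k j + εh * ∏ j ∈ S, r j := by
      intro i hi hstep
      have hT : (S.erase i).card = n := by rw [Finset.card_erase_of_mem hi, hcard]; simp
      have ihT := ih (S.erase i) hT (fun j hj => hx j (Finset.mem_of_mem_erase hj))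
        (fun j hj => hr j (Finset.mem_of_mem_erase hj)) (fun j hj => hrk j (Finset.mem_of_mem_erase hj))
        (fun j hj => hcov j (Finset.mem_of_mem_erase hj))
      have hVi : 0 ≤ c + εY * x i + εg * k i + εh * r i := by
        have := hx i hi; have := hr i hi; have := hrk i hi
        nlinarith [mul_nonneg hY (by linarith : (0:ℝ) ≤ x i), mul_nonneg hg (by linarith : (0:ℝ) ≤ k i),
          mul_nonneg hh (by linarith : (0:ℝ) ≤ r i)]
      rw [← Finset.mul_prod_erase S _ hi, ← Finset.prod_erase_mul S x hi, ← Finset.prod_erase_mul S k hi,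
        ← Finset.prod_erase_mul S r hi]
      calc (c + εY * x i + εg * k i + εh * r i) * ∏ j ∈ S.erase i, (c + εY * x j + εg * k j + εh * r j)
          ≤ (c + εY * x i + εg * k i + εh * r i) *
              (c + εY * ∏ j ∈ S.erase i, x j + εg * ∏ j ∈ S.erase i, k j + εh * ∏ j ∈ S.erase i, r j) :=
            mul_le_mul_of_nonneg_left ihT hVi
        _ = (c + εY * ∏ j ∈ S.erase i, x j + εg * ∏ j ∈ S.erase i, k j + εh * ∏ j ∈ S.erase i, r j) *
              (c + εY * x i + εg * k i + εh * r i) := by ring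
        _ ≤ _ := hstep
    -- merged-state facts for any T ⊆ S
    have stR : ∀ T : Finset ι, T ⊆ S → 1 ≤ ∏ j ∈ T, r j := fun T hT => by
      have : ∏ j ∈ T, (1:ℝ) ≤ ∏ j ∈ T, r j := Finset.prod_le_prod (fun _ _ => zero_le_one) (fun j hj => hr j (hT hj))
      simpa using this
    have stX : ∀ T : Finset ι, T ⊆ S → 1 ≤ ∏ j ∈ T, x j := fun T hT => by
      have : ∏ j ∈ T, (1:ℝ) ≤ ∏ j ∈ T, x j := Finset.prod_le_prod (fun _ _ => zero_le_one) (fun j hj => hx j (hT hj))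
      simpa using this
    have stRK : ∀ T : Finset ι, T ⊆ S → ∏ j ∈ T, r j ≤ ∏ j ∈ T, k j := fun T hT =>
      Finset.prod_le_prod (fun j hj => zero_le_one.trans (hr j (hT hj))) (fun j hj => hrk j (hT hj))
    by_cases hC : ∃ i ∈ S, x i < r i
    · -- peel a type-C petal; the rest can be in state A, B or C
      obtain ⟨i, hi, hxi⟩ := hC
      refine peel i hi ?_
      set X := ∏ j ∈ S.erase i, x j; set K := ∏ j ∈ S.erase i, k j; set R := ∏ j ∈ S.erase i, r j
      have hR1 : 1 ≤ R := stR _ (Finset.erase_subset i S)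
      have hX1 : 1 ≤ X := stX _ (Finset.erase_subset i S)
      have hRK : R ≤ K := stRK _ (Finset.erase_subset i S)
      rcases le_total K X with hKX | hXK
      · exact step_stateA hc hY hg hh hsum hR1 hRK hKX (hx i hi) (hr i hi) (hrk i hi) (hcov i hi)
      rcases le_total R X with hRX | hXR
      · exact step_stateB_petalC hc hY hg hh hsum hR1 hRX hXK (hx i hi) hxi.le (hrk i hi) (hcov i hi)
      · exact step_same_C hc hY hg hh hsum hX1 hXR hRK (hx i hi) hxi.le (hrk i hi)
    · push Not at hC   -- every petal has r ≤ x
      by_cases hB : ∃ i ∈ S, x i < k i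
      · obtain ⟨i, hi, hxi⟩ := hB
        refine peel i hi ?_
        set X := ∏ j ∈ S.erase i, x j; set K := ∏ j ∈ S.erase i, k j; set R := ∏ j ∈ S.erase i, r j
        have hR1 : 1 ≤ R := stR _ (Finset.erase_subset i S)
        have hRK : R ≤ K := stRK _ (Finset.erase_subset i S)
        have hRX : R ≤ X := Finset.prod_le_prod (fun j hj => zero_le_one.trans (hr j (Finset.mem_of_mem_erase hj)))
          (fun j hj => hC j (Finset.mem_of_mem_erase hj))
        rcases le_total K X with hKX | hXK
        · exact step_stateA hc hY hg hh hsum hR1 hRK hKX (hx i hi) (hr i hi) (hrk i hi) (hcov i hi)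
        · exact step_same_B hc hY hg hh hsum hR1 hRX hXK (hr i hi) (hC i hi) hxi.le
      · push Not at hB   -- every petal has k ≤ x (type A)
        obtain ⟨i, hi⟩ := hne
        refine peel i hi ?_
        set X := ∏ j ∈ S.erase i, x j; set K := ∏ j ∈ S.erase i, k j; set R := ∏ j ∈ S.erase i, r j
        have hR1 : 1 ≤ R := stR _ (Finset.erase_subset i S)
        have hRK : R ≤ K := stRK _ (Finset.erase_subset i S)
        have hKX : K ≤ X := Finset.prod_le_prod
          (fun j hj => (zero_le_one.trans (hr j (Finset.mem_of_mem_erase hj))).trans (hrk j (Finset.mem_of_mem_erase hj)))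
          (fun j hj => hB j (Finset.mem_of_mem_erase hj))
        exact step_same_A hc hY hg hh hsum hR1 hRK hKX (hr i hi) (hrk i hi) (hB i hi)

set_option maxHeartbeats 1000000 in
/-- **(RES0′) FOR EVERY NUMBER OF PETALS ON THE WHOLE CLASS `h ≤ k`** (model form of `classK_prod_le`).  Parameters `τ ∈ (0,1)`,
`σ ∈ [0,1)`, `s ∈ [0,1]`, floors `0 < α₀₀ ≤ α₀₁ ≤ α₁₁`, constant `c₀ ≥ (1−s)(1−τ)α₀₀` (any leaf-leaf constant; the bare HCS constant is
NOT enough here), `p = τ(1−σ)`, `q = s(1−τ)`, `b_Ȳ, b_H, g` as usual.  Petals `j ∈ S ≠ ∅` with `α₀₀ ≤ y_j`, `α₀₁ ≤ g_j ≤ k_j`,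
`α₁₁ ≤ h_j ≤ k_j` (no cap on `k` is needed) (K-DOMINANT: the h-cell below the k-cell — full petals, hubs, H-hubs, dwarfs, diagonal petals; everything except
h-rich petals).  Under (BȲ) `∏Ȳ_j ≤ b_Ȳ^(|S|−1)`, (Bk) `∏k_j ≤ α₀₁^(|S|−1)`, (Bh) `∏h_j ≤ α₁₁^(|S|−1)`:
`∏_j (c₀ + pȲ_j + q((1−σ)g_j + σh_j)) ≤ g^(|S|−1)·(c₀ + p + q)`.  The cover of `classK_prod_le` is the leaf-leaf-constant inequality
`(c₀ + q b_H)(Ȳ_j − b_Ȳ) ≥ q b_Ȳ (k_j − α₀₁) ≥ b_Ȳ q[(1−σ)(k_j−α₀₁) + σ(h_j−α₁₁)]`. [this work] -/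
theorem res0_classK {κ : Type*} [DecidableEq κ] {τ σ s α00 α01 α11 c0 : ℝ} (hτ0 : 0 < τ) (hτ1 : τ < 1)
    (hσ0 : 0 ≤ σ) (hσ1 : σ < 1) (hs0 : 0 ≤ s) (hs1 : s ≤ 1) (hα00 : 0 < α00) (h01 : α00 ≤ α01) (h11 : α01 ≤ α11)
    (hc0 : (1 - s) * (1 - τ) * α00 ≤ c0)
    (S : Finset κ) (hS : S.Nonempty) (y k gc h : κ → ℝ)
    (hy : ∀ j ∈ S, α00 ≤ y j) (hg : ∀ j ∈ S, α01 ≤ gc j) (hgk : ∀ j ∈ S, gc j ≤ k j)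
    (hh : ∀ j ∈ S, α11 ≤ h j) (hhk : ∀ j ∈ S, h j ≤ k j)
    (hBY : ∏ j ∈ S, ((1 - s) * y j + s * k j) ≤ ((1 - s) * α00 + s * α01) ^ (S.card - 1))
    (hBk : ∏ j ∈ S, k j ≤ α01 ^ (S.card - 1)) (hBh : ∏ j ∈ S, h j ≤ α11 ^ (S.card - 1)) :
    ∏ j ∈ S, (c0 + τ * (1 - σ) * ((1 - s) * y j + s * k j) + s * (1 - τ) * ((1 - σ) * gc j + σ * h j)) ≤
      (c0 + τ * (1 - σ) * ((1 - s) * α00 + s * α01) + s * (1 - τ) * ((1 - σ) * α01 + σ * α11)) ^ (S.card - 1) *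
        (c0 + τ * (1 - σ) + s * (1 - τ)) := by
  have hα01 : 0 < α01 := lt_of_lt_of_le hα00 h01
  have hα11 : 0 < α11 := lt_of_lt_of_le hα01 h11
  have hp0 : 0 < τ * (1 - σ) := mul_pos hτ0 (by linarith)
  have hpnn : 0 ≤ τ * (1 - σ) := hp0.le
  have hqnn : 0 ≤ s * (1 - τ) := mul_nonneg hs0 (by linarith)
  have hc0nn : 0 ≤ c0 := le_trans (mul_nonneg (mul_nonneg (by linarith) (by linarith)) hα00.le) hc0
  have hbY0 : 0 < (1 - s) * α00 + s * α01 := by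
    rcases eq_or_lt_of_le hs1 with h | h
    · rw [h]; simpa using hα01
    · nlinarith [mul_pos (sub_pos.2 h) hα00, mul_nonneg hs0 hα01.le]
  have hbH0 : 0 < (1 - σ) * α01 + σ * α11 := by nlinarith [mul_pos (sub_pos.2 hσ1) hα01, mul_nonneg hσ0 hα11.le]
  obtain ⟨bY, hbY⟩ : ∃ b, b = (1 - s) * α00 + s * α01 := ⟨_, rfl⟩
  obtain ⟨bH, hbH⟩ : ∃ b, b = (1 - σ) * α01 + σ * α11 := ⟨_, rfl⟩
  rw [← hbY] at hBY hbY0 ⊢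
  rw [← hbH] at hbH0 ⊢
  obtain ⟨g, hgdef⟩ : ∃ t, t = c0 + τ * (1 - σ) * bY + s * (1 - τ) * bH := ⟨_, rfl⟩
  rw [← hgdef]
  have hgpos : 0 < g := by rw [hgdef]; nlinarith [mul_pos hp0 hbY0, mul_nonneg hqnn hbH0.le]
  obtain ⟨n, hn⟩ : ∃ n, n = S.card := ⟨_, rfl⟩
  have hn1 : 1 ≤ n := by rw [hn]; exact Finset.card_pos.2 hS
  rw [← hn] at hBY hBk hBh ⊢
  have hcardS : S.card = n := hn.symm
  -- weights
  obtain ⟨w₀, hw0⟩ : ∃ t, t = c0 / g := ⟨_, rfl⟩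
  obtain ⟨wY, hwY⟩ : ∃ t, t = τ * (1 - σ) * bY / g := ⟨_, rfl⟩
  obtain ⟨wg, hwg⟩ : ∃ t, t = s * (1 - τ) * (1 - σ) * α01 / g := ⟨_, rfl⟩
  obtain ⟨wh, hwh⟩ : ∃ t, t = s * (1 - τ) * σ * α11 / g := ⟨_, rfl⟩
  have hw0n : 0 ≤ w₀ := by rw [hw0]; exact div_nonneg hc0nn hgpos.le
  have hwYn : 0 ≤ wY := by rw [hwY]; exact div_nonneg (mul_nonneg hpnn hbY0.le) hgpos.le
  have hwgn : 0 ≤ wg := by rw [hwg]; exact div_nonneg (mul_nonneg (mul_nonneg hqnn (by linarith)) hα01.le) hgpos.le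
  have hwhn : 0 ≤ wh := by rw [hwh]; positivity
  have hwsum : w₀ + wY + wg + wh = 1 := by
    rw [hw0, hwY, hwg, hwh]; field_simp; rw [hgdef, hbH]; ring
  -- usages and the hypotheses of classK_prod_le
  have hx1 : ∀ j ∈ S, 1 ≤ ((1 - s) * y j + s * k j) / bY := fun j hj => by
    rw [le_div_iff₀ hbY0, hbY]
    have h1 := mul_le_mul_of_nonneg_left (hy j hj) (by linarith : (0:ℝ) ≤ 1 - s)
    have h2 := mul_le_mul_of_nonneg_left ((hg j hj).trans (hgk j hj)) hs0
    linarith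
  have hr1 : ∀ j ∈ S, 1 ≤ h j / α11 := fun j hj => by rw [le_div_iff₀ hα11]; linarith [hh j hj]
  have hrk : ∀ j ∈ S, h j / α11 ≤ k j / α01 := fun j hj => by
    rw [div_le_div_iff₀ hα11 hα01]
    have h1 := mul_le_mul_of_nonneg_left (hhk j hj) hα01.le
    have h2 := mul_le_mul_of_nonneg_left h11 ((hα11.le.trans (hh j hj)))
    nlinarith
  have hLL : (1 - τ) * bY ≤ c0 + s * (1 - τ) * bH := by
    rw [hbY, hbH]
    nlinarith [mul_nonneg (mul_nonneg hs0 (by linarith : (0:ℝ) ≤ 1 - τ)) (mul_nonneg hσ0 (sub_nonneg.2 h11)),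
      mul_nonneg (mul_nonneg hs0 (by linarith : (0:ℝ) ≤ 1 - τ)) hα01.le]
  have hcov : ∀ j ∈ S, wg * (k j / α01 - 1) + wh * (h j / α11 - 1) ≤ (w₀ + wg + wh) * (((1 - s) * y j + s * k j) / bY - 1) :=
    fun j hj => by
    have e1 : wg * (k j / α01 - 1) + wh * (h j / α11 - 1) =
        (s * (1 - τ) * ((1 - σ) * (k j - α01) + σ * (h j - α11))) / g := by rw [hwg, hwh]; field_simp
    have e2 : (w₀ + wg + wh) * (((1 - s) * y j + s * k j) / bY - 1) =
        (c0 + s * (1 - τ) * bH) * (((1 - s) * y j + s * k j) - bY) / (g * bY) := by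
      rw [hw0, hwg, hwh]; field_simp; rw [hbH]; ring
    rw [e1, e2, div_le_div_iff₀ hgpos (mul_pos hgpos hbY0)]
    have hYex : s * (k j - α01) ≤ ((1 - s) * y j + s * k j) - bY := by
      have h1 := mul_le_mul_of_nonneg_left (hy j hj) (by linarith : (0:ℝ) ≤ 1 - s)
      rw [hbY]; linarith
    have hshape : (1 - σ) * (k j - α01) + σ * (h j - α11) ≤ k j - α01 := by
      have h1 := mul_le_mul_of_nonneg_left (show h j - α11 ≤ k j - α01 by linarith [hhk j hj]) hσ0
      linarith
    have hkq : 0 ≤ k j - α01 := by linarith [hg j hj, hgk j hj]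
    have hcq : 0 ≤ c0 + s * (1 - τ) * bH := by linarith [mul_nonneg hqnn hbH0.le]
    have hkey : s * (1 - τ) * bY ≤ s * (c0 + s * (1 - τ) * bH) := by
      have := mul_le_mul_of_nonneg_left hLL hs0; linarith
    calc s * (1 - τ) * ((1 - σ) * (k j - α01) + σ * (h j - α11)) * (g * bY)
        ≤ s * (1 - τ) * (k j - α01) * (g * bY) := by
          have := mul_le_mul_of_nonneg_left hshape (mul_nonneg hqnn (mul_nonneg hgpos.le hbY0.le)); linarith
      _ = (s * (1 - τ) * bY) * (k j - α01) * g := by ring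
      _ ≤ (s * (c0 + s * (1 - τ) * bH)) * (k j - α01) * g := by gcongr
      _ = (c0 + s * (1 - τ) * bH) * (s * (k j - α01)) * g := by ring
      _ ≤ (c0 + s * (1 - τ) * bH) * (((1 - s) * y j + s * k j) - bY) * g := by gcongr
  have hK := classK_prod_le hw0n hwYn hwgn hwhn hwsum (fun j => ((1 - s) * y j + s * k j) / bY) (fun j => k j / α01)
    (fun j => h j / α11) S hx1 hr1 hrk hcov
  -- G_j ≤ g·W_j (g raised to k), nonnegativity, products
  have hGW : ∀ j ∈ S, c0 + τ * (1 - σ) * ((1 - s) * y j + s * k j) + s * (1 - τ) * ((1 - σ) * gc j + σ * h j) ≤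
      g * (w₀ + wY * (((1 - s) * y j + s * k j) / bY) + wg * (k j / α01) + wh * (h j / α11)) := fun j hj => by
    have e : g * (w₀ + wY * (((1 - s) * y j + s * k j) / bY) + wg * (k j / α01) + wh * (h j / α11)) =
        c0 + τ * (1 - σ) * ((1 - s) * y j + s * k j) + s * (1 - τ) * ((1 - σ) * k j + σ * h j) := by
      rw [hw0, hwY, hwg, hwh]; field_simp; ring
    rw [e]; nlinarith [mul_nonneg (mul_nonneg hqnn (by linarith : (0:ℝ) ≤ 1 - σ)) (sub_nonneg.2 (hgk j hj))]
  have hGnn : ∀ j ∈ S, 0 ≤ c0 + τ * (1 - σ) * ((1 - s) * y j + s * k j) + s * (1 - τ) * ((1 - σ) * gc j + σ * h j) :=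
    fun j hj => by
      have hy0 : 0 ≤ y j := hα00.le.trans (hy j hj)
      have hk0 : 0 ≤ k j := (hα01.le.trans (hg j hj)).trans (hgk j hj)
      have := mul_nonneg hpnn (add_nonneg (mul_nonneg (by linarith : (0:ℝ) ≤ 1 - s) hy0) (mul_nonneg hs0 hk0))
      have := mul_nonneg hqnn (add_nonneg (mul_nonneg (by linarith : (0:ℝ) ≤ 1 - σ) (hα01.le.trans (hg j hj)))
        (mul_nonneg hσ0 (hα11.le.trans (hh j hj))))
      linarith
  have step1 : ∏ j ∈ S, (c0 + τ * (1 - σ) * ((1 - s) * y j + s * k j) + s * (1 - τ) * ((1 - σ) * gc j + σ * h j)) ≤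
      ∏ j ∈ S, (g * (w₀ + wY * (((1 - s) * y j + s * k j) / bY) + wg * (k j / α01) + wh * (h j / α11))) :=
    Finset.prod_le_prod hGnn hGW
  have step2 : ∏ j ∈ S, (g * (w₀ + wY * (((1 - s) * y j + s * k j) / bY) + wg * (k j / α01) + wh * (h j / α11))) =
      g ^ n * ∏ j ∈ S, (w₀ + wY * (((1 - s) * y j + s * k j) / bY) + wg * (k j / α01) + wh * (h j / α11)) := by
    rw [Finset.prod_mul_distrib, Finset.prod_const, hcardS]
  have hpow : ∀ {b : ℝ}, 0 < b → ∀ {U : ℝ}, U ≤ b ^ (n - 1) → U / b ^ n ≤ 1 / b := by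
    intro b hb U hU
    rw [div_le_div_iff₀ (pow_pos hb n) hb]
    have e : b ^ n = b ^ (n - 1) * b := by rw [← pow_succ]; congr 1; omega
    rw [e]; have := mul_le_mul_of_nonneg_right hU hb.le; linarith
  have hX : ∏ j ∈ S, ((1 - s) * y j + s * k j) / bY ≤ 1 / bY := by
    rw [Finset.prod_div_distrib, Finset.prod_const, hcardS]; exact hpow hbY0 hBY
  have hKb : ∏ j ∈ S, k j / α01 ≤ 1 / α01 := by
    rw [Finset.prod_div_distrib, Finset.prod_const, hcardS]; exact hpow hα01 hBk
  have hR : ∏ j ∈ S, h j / α11 ≤ 1 / α11 := by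
    rw [Finset.prod_div_distrib, Finset.prod_const, hcardS]; exact hpow hα11 hBh
  have step4 : w₀ + wY * ∏ j ∈ S, ((1 - s) * y j + s * k j) / bY + wg * ∏ j ∈ S, k j / α01 + wh * ∏ j ∈ S, h j / α11 ≤
      (c0 + τ * (1 - σ) + s * (1 - τ)) / g := by
    have e : (c0 + τ * (1 - σ) + s * (1 - τ)) / g = w₀ + wY * (1 / bY) + wg * (1 / α01) + wh * (1 / α11) := by
      rw [hw0, hwY, hwg, hwh]; field_simp; ring
    rw [e]
    have := mul_le_mul_of_nonneg_left hX hwYn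
    have := mul_le_mul_of_nonneg_left hKb hwgn
    have := mul_le_mul_of_nonneg_left hR hwhn
    linarith
  have hgn : 0 ≤ g ^ n := pow_nonneg hgpos.le n
  calc ∏ j ∈ S, (c0 + τ * (1 - σ) * ((1 - s) * y j + s * k j) + s * (1 - τ) * ((1 - σ) * gc j + σ * h j))
      ≤ g ^ n * ∏ j ∈ S, (w₀ + wY * (((1 - s) * y j + s * k j) / bY) + wg * (k j / α01) + wh * (h j / α11)) := by
        rw [← step2]; exact step1
    _ ≤ g ^ n * ((c0 + τ * (1 - σ) + s * (1 - τ)) / g) := mul_le_mul_of_nonneg_left (hK.trans step4) hgn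
    _ = g ^ (n - 1) * (c0 + τ * (1 - σ) + s * (1 - τ)) := by
        have : g ^ n = g ^ (n - 1) * g := by rw [← pow_succ]; congr 1; omega
        rw [this]; field_simp

end Summit.CriticalPhenomena.PercolationContinuityZ3.Theorems.SunflowerPartition.SafeCalc.LinkedCurrency
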